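import Summits.BirchSwinnertonDyer.BirchSwinnertonDyer.Theorems.GenusKolyvaginAtTwoMinimalTwinBSDTwoComponentRoad
import Summits.BirchSwinnertonDyer.BirchSwinnertonDyer.Theorems.GenusKolyvaginAtTwoMinimalTwinBSDTwoSwappedPairRationalHeegnerPoint
import HarnessLib

/-!
# Route `GenusKolyvaginAtTwo`, crux U₂ `MinimalTwinBSDTwo` (stmt-BirchSwinnertonDyer-22985), LINE 23 «twin_swap», stub DIV′:
# THE COMPONENT ROAD ON THE RANK-ONE FRAME — `2^s ∣ y_K` from the component class of a generator of `W(ℚ)`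

Seat `bsd-line-gk2-p2` g29 (PROVER 2/3, cell `bsd-f1-sign2`; LINE 23 holder), `--supports stmt-BirchSwinnertonDyer-22985` (helper; closes nothing).
THEOREMS ONLY (no definition, no named fact, no `sorry`); standard axioms.  **BSD is NOT proved by this file; U₂ / DIV′ are NOT proved; no item is
closed.**  CONDITIONAL (D-0014) on the statement-only PUBLISHED fact `Gross1991_heegnerPoint_sub_ratTorsion_mem_E0_imageFree` (Gross 1991 §6 /
Gross–Zagier 1986 III (3.1)), displayed.  Sequel of `…MinimalTwinBSDTwoComponentRoad` (p795032; §4 `exists_two_pow_smul_eq_derivedPoint_one_of_componentOrder`: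
`2^s ∣ P(1)` from a decomposition `P(1) = a • g₁ + t₁`, `t₁` of odd order, and the component class of `g₁` at one place above `N`).

THIS FILE supplies the decomposition on LINE 23's frames.  For `W/ℚ` globally minimal with `E(ℚ)[2] = 0` and `w(W) = −1`, a Heegner field `K` of
ODD discriminant `d_K ≠ −3`, and a conductor-`1` datum: gk2-p4 g26's RATIONAL Heegner point (`TwinSwapBit.exists_rational_heegnerPoint_of_rootNumber_eq_neg_one`:
`ι Y = P₀ + 2u`, `Y ∈ E(ℚ)`, `u` torsion) and ANY `g ∈ E(ℚ)` generating `E(ℚ)` modulo torsion (`Y − k • g` torsion for some `k`) give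
`P(1) = k • g₁ + t₁` in `E(K[1])` with `g₁` the image of `g` and `t₁` of ODD order (`E(K)[2] = 0` for a Heegner field of odd `d_K`,
`TwinSwap.forall_two_zsmul_baseChange_eq_zero_of_heegner`).  Hence:

* ★ `exists_two_pow_smul_eq_derivedPoint_one_of_generator_componentOrder` — **if the image `g₁ ∈ E(K[1])` of a generator `g` of `E(ℚ)/tors` has
  component class of `2`-order `≥ 2^s` at ONE place `w₀ ∣ N_W` of `K[1]` («`k • g₁ ∈ E₀(K[1])_{w₀} ⟹ 2^s ∣ k`»), then `2^s ∣ P(1)` in `E(K[1])`**,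
  granted GZ III (3.1).  (`rank E(ℚ) ≤ 1` supplies such a `g`: TYZ-file `exists_generator_mod_torsion`; on U₂'s frames `rank = 1`.)
* `…_of_analyticRank_eq_one` — the same with `w(W) = −1` replaced by `r_an(W) = 1` (parity through the datum, `TwinSwapBit.rootNumber_eq_neg_one_of_analyticRank_eq_one`).

READING (census, not progress on BSD).  With `s = ord₂ C(W)` on a frame where ONE bad place sees the whole `2`-part of the Tamagawa product through
the generator, this is the divisibility half «`2^{ord₂ C(W)} ∣ P(1)`» of v2.5's DIV′ on `Ш(W_K)`-trivial odd-`c` frames — the statement gk2-p2 g28 drew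
from crux 27467 (Jetchev at `2`, beyond print) on the slice 𝒮 — now from PRINT (GZ III (3.1)).  MAX-type: one place at a time.  The hypothesis is
stated at a place of `K[1]`; reading it on `Φ_{q₀}(ℚ_{q₀})` (unramified descent `K[1]_{w₀} ⊇ ℚ_{q₀}`) is routine and left to the consumer
(`CarrierLocalE0.hasNonsingularReduction_placeIntModel_iff_mapPoint_mem` is the model).

References: [GrossLMS1991] §6 proof of Prop. 6.2 (1) (p. 245), §4 (4.1), §5 Prop. 5.3; [GrossZagier1986Heegner] III (3.1); [Darmon2004] Prop. 3.11;
[SilvermanAEC2009] VII §2 Prop. 2.1, VIII §2.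
-/

set_option autoImplicit false
set_option linter.dupNamespace false -- `Summit.<P>.<Sub>` repeats `BirchSwinnertonDyer` (D-0017)

noncomputable section

open scoped Classical

open NumberField WeierstrassCurve IsDedekindDomain
open Literature.NumberTheory.EllipticCurves Literature.NumberTheory.EllipticCurves.ModularForms
open Summit.BirchSwinnertonDyer.BirchSwinnertonDyer.Theorems.GenusExact.TwinSwap (forall_two_zsmul_baseChange_eq_zero_of_heegner)
open Summit.BirchSwinnertonDyer.BirchSwinnertonDyer.Theorems.GenusExact.TwinSwapBit
  (exists_rational_heegnerPoint_of_rootNumber_eq_neg_one rootNumber_eq_neg_one_of_analyticRank_eq_one)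

namespace Summit.BirchSwinnertonDyer.BirchSwinnertonDyer.Theorems.GenusExact.TwinSwap.ComponentRoad

/-! ## §5 The decomposition `P(1) = k • g₁ + t₁` on the rank-one frame, and the road -/

/-- In an additive commutative group without `2`-torsion every element of finite order has ODD order. [folklore] -/
theorem odd_addOrderOf_of_forall_two_zsmul {A : Type*} [AddCommGroup A] (h2 : ∀ x : A, (2 : ℤ) • x = 0 → x = 0)
    {t : A} (ht : IsOfFinAddOrder t) : Odd (addOrderOf t) := by
  by_contra hodd
  rw [Nat.not_odd_iff_even] at hodd
  obtain ⟨k, hk⟩ := hodd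
  have hpos : 0 < addOrderOf t := ht.addOrderOf_pos
  have hkt : k • t = 0 := h2 (k • t) (by
    rw [show (2 : ℤ) • (k • t) = (k + k) • t by rw [two_zsmul, add_nsmul], ← hk]
    exact addOrderOf_nsmul_eq_zero t)
  have hdvd : addOrderOf t ∣ k := addOrderOf_dvd_of_nsmul_eq_zero hkt
  have hle : addOrderOf t ≤ k := Nat.le_of_dvd (by omega) hdvd
  omega

/-- ★ **THE COMPONENT ROAD ON THE RANK-ONE FRAME.**  `W/ℚ` globally minimal with `E(ℚ)[2] = 0` and `w(W) = −1`; `K` imaginary quadratic with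
ODD `d_K ≠ −3`, Heegner for `N_W`; a conductor-`1` Kolyvagin–Heegner datum `d₁` (`P(1) = y_K`); `g ∈ E(ℚ)` generating `E(ℚ)` modulo torsion
(`∀ x, ∃ k, x − k • g` torsion); ONE place `w₀ ∣ N_W` of `K[1]` at which the component class of the image `g₁` of `g` has `2`-order `≥ 2^s`
(«`k • g₁ ∈ E₀(K[1])_{w₀} ⟹ 2^s ∣ k`»).  Granted GZ III (3.1) (`Gross1991_heegnerPoint_sub_ratTorsion_mem_E0_imageFree`, displayed):
**`∃ Q ∈ E(K[1]), 2^s • Q = P(1)`**.  Proof: the rational Heegner point `Y` (`ι Y = P₀ + 2u`) is `k • g + t_ℚ`, so `P(1) = k • g₁ + t₁` with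
`t₁` the image of `ι t_ℚ − 2u ∈ E(K)_tors`, of odd order since `E(K)[2] = 0`; then p795032's §4.  CONDITIONAL on the displayed fact; BSD is NOT
proved; nothing is closed. [cite: GrossLMS1991, §6, proof of Prop. 6.2 (1), p. 245; §5 Prop. 5.3] [cite: GrossZagier1986Heegner, III (3.1)]
[cite: Darmon2004, Prop. 3.11] -/
theorem exists_two_pow_smul_eq_derivedPoint_one_of_generator_componentOrder
    (hGZ31 : Gross1991_heegnerPoint_sub_ratTorsion_mem_E0_imageFree)
    (W : WeierstrassCurve ℚ) [W.IsElliptic] [W.IsGloballyMinimal] [NeZero (W.conductorNorm ℤ)]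
    (hT2 : ∀ P : W.toAffine.Point, 2 • P = 0 → P = 0) (hw : W.rootNumber = -1)
    {K : Type} [Field K] [NumberField K] (hK : IsImaginaryQuadratic K) (hodd : Odd (NumberField.discr K))
    (h3 : NumberField.discr K ≠ -3) (hH : SatisfiesHeegnerHypothesis (W.conductorNorm ℤ) K)
    (Dt : ModularParametrizationData W (W.conductorNorm ℤ)) (β : ℤ) (ι : K →+* ℂ) [NumberField (ringClassField K ι 1)]
    (d₁ : KolyvaginHeegnerData Dt β ι 1)
    (g : W.toAffine.Point)
    (hg : ∀ x : W.toAffine.Point, ∃ k : ℤ, IsOfFinAddOrder (QuadraticDescent.incl K W x - k • QuadraticDescent.incl K W g))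
    (w₀ : HeightOneSpectrum (𝓞 (ringClassField K ι 1)))
    (hw₀ : (((W.conductorNorm ℤ : ℕ) : ℕ) : 𝓞 (ringClassField K ι 1)) ∈ w₀.asIdeal) (s : ℕ)
    (hs : ∀ k : ℤ, WeierstrassCurve.HasNonsingularReduction (K := ringClassField K ι 1)
      (placeIntModel W (ringClassField K ι 1) w₀) (k • W.pointToBaseChange (ringClassField K ι 1) g) → ((2 ^ s : ℕ) : ℤ) ∣ k) :
    ∃ Q : (W.baseChange (ringClassField K ι 1)).toAffine.Point, ((2 ^ s : ℕ) : ℤ) • Q = d₁.derivedPoint := by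
  have hD : NumberField.discr K ≠ -3 ∧ NumberField.discr K ≠ -4 := by
    refine ⟨h3, fun h4 ↦ ?_⟩
    rw [h4] at hodd
    exact (Int.not_even_iff_odd.mpr hodd) ⟨-2, by norm_num⟩
  -- no `2`-torsion over `K`
  have h2K : ∀ x : (W.baseChange K).toAffine.Point, (2 : ℤ) • x = 0 → x = 0 := fun x hx ↦
    forall_two_zsmul_baseChange_eq_zero_of_heegner W K hK hodd hH hT2 x hx
  -- the rational Heegner point `Y`: `ι Y = P₀ + 2u`
  obtain ⟨P₀, Y, u, hP₀, hu, hY⟩ := exists_rational_heegnerPoint_of_rootNumber_eq_neg_one W hK hH hw h2K Dt β ι d₁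
  -- `ι Y = k • ι g + (torsion)`
  obtain ⟨k, htY⟩ := hg Y
  -- the map `f : E(K) → E(K[1])`
  set f : (W.baseChange K).toAffine.Point →+ (W.baseChange (ringClassField K ι 1)).toAffine.Point :=
    WeierstrassCurve.Affine.Point.map (W' := W) (algebraMap K (ringClassField K ι 1)).toRatAlgHom with hfdef
  have hfinj : Function.Injective f :=
    WeierstrassCurve.Affine.Point.map_injective (W' := W) (algebraMap K (ringClassField K ι 1)).toRatAlgHom
  have hfι : f (QuadraticDescent.incl K W g) = W.pointToBaseChange (ringClassField K ι 1) g := by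
    rcases g with _ | ⟨x, y, hxy⟩
    · rfl
    · simp only [hfdef, WeierstrassCurve.pointToBaseChange]
      have hx : ((algebraMap K (ringClassField K ι 1)).toRatAlgHom : K →ₐ[ℚ] ringClassField K ι 1) (algebraMap ℚ K x) =
          algebraMap ℚ (ringClassField K ι 1) x := by
        rw [RingHom.toRatAlgHom_apply, eq_ratCast (algebraMap ℚ K), eq_ratCast (algebraMap ℚ (ringClassField K ι 1)), map_ratCast]
      have hy : ((algebraMap K (ringClassField K ι 1)).toRatAlgHom : K →ₐ[ℚ] ringClassField K ι 1) (algebraMap ℚ K y) =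
          algebraMap ℚ (ringClassField K ι 1) y := by
        rw [RingHom.toRatAlgHom_apply, eq_ratCast (algebraMap ℚ K), eq_ratCast (algebraMap ℚ (ringClassField K ι 1)), map_ratCast]
      exact (Affine.Point.some.injEq _ _ _ _ _ _).mpr ⟨hx, hy⟩
  -- the torsion part over `K`, of odd order
  set tK : (W.baseChange K).toAffine.Point := P₀ - k • QuadraticDescent.incl K W g with htKdef
  have htK : IsOfFinAddOrder tK := by
    have h1 : tK = (QuadraticDescent.incl K W Y - k • QuadraticDescent.incl K W g) + -((2 : ℤ) • u) := by
      rw [htKdef, eq_sub_of_add_eq hY.symm]; abel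
    rw [h1]
    exact htY.add (hu.zsmul (i := 2) |>.neg)
  have hoddK : Odd (addOrderOf tK) := odd_addOrderOf_of_forall_two_zsmul h2K htK
  -- the decomposition of `P(1)`
  have hP₀dec : P₀ = k • QuadraticDescent.incl K W g + tK := by rw [htKdef, add_sub_cancel]
  have hdec : d₁.derivedPoint = k • W.pointToBaseChange (ringClassField K ι 1) g + f tK := by
    rw [← hP₀, hP₀dec, map_add, map_zsmul, hfι]
  have hodd₁ : Odd (addOrderOf (f tK)) := by
    rw [addOrderOf_injective f hfinj tK]
    exact hoddK
  exact exists_two_pow_smul_eq_derivedPoint_one_of_componentOrder hGZ31 hT2 hK hD hH d₁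
    (W.pointToBaseChange (ringClassField K ι 1) g) (f tK) k hdec hodd₁ w₀ hw₀ s hs

/-- **The same on U₂'s frames, with `r_an(W) = 1` in place of `w(W) = −1`** (parity through the conductor-level datum).  CONDITIONAL on the
displayed fact; BSD is NOT proved; nothing is closed. [cite: GrossLMS1991, §6, proof of Prop. 6.2 (1), p. 245] [cite: GrossZagier1986Heegner, III (3.1)] -/
theorem exists_two_pow_smul_eq_derivedPoint_one_of_generator_componentOrder_of_analyticRank_eq_one
    (hGZ31 : Gross1991_heegnerPoint_sub_ratTorsion_mem_E0_imageFree)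
    (W : WeierstrassCurve ℚ) [W.IsElliptic] [W.IsGloballyMinimal] [NeZero (W.conductorNorm ℤ)]
    (hT2 : ∀ P : W.toAffine.Point, 2 • P = 0 → P = 0) (hr : W.analyticRank = 1)
    {K : Type} [Field K] [NumberField K] (hK : IsImaginaryQuadratic K) (hodd : Odd (NumberField.discr K))
    (h3 : NumberField.discr K ≠ -3) (hH : SatisfiesHeegnerHypothesis (W.conductorNorm ℤ) K)
    (Dt : ModularParametrizationData W (W.conductorNorm ℤ)) (β : ℤ) (ι : K →+* ℂ) [NumberField (ringClassField K ι 1)]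
    (d₁ : KolyvaginHeegnerData Dt β ι 1)
    (g : W.toAffine.Point)
    (hg : ∀ x : W.toAffine.Point, ∃ k : ℤ, IsOfFinAddOrder (QuadraticDescent.incl K W x - k • QuadraticDescent.incl K W g))
    (w₀ : HeightOneSpectrum (𝓞 (ringClassField K ι 1)))
    (hw₀ : (((W.conductorNorm ℤ : ℕ) : ℕ) : 𝓞 (ringClassField K ι 1)) ∈ w₀.asIdeal) (s : ℕ)
    (hs : ∀ k : ℤ, WeierstrassCurve.HasNonsingularReduction (K := ringClassField K ι 1)
      (placeIntModel W (ringClassField K ι 1) w₀) (k • W.pointToBaseChange (ringClassField K ι 1) g) → ((2 ^ s : ℕ) : ℤ) ∣ k) :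
    ∃ Q : (W.baseChange (ringClassField K ι 1)).toAffine.Point, ((2 ^ s : ℕ) : ℤ) • Q = d₁.derivedPoint :=
  exists_two_pow_smul_eq_derivedPoint_one_of_generator_componentOrder hGZ31 W hT2 (rootNumber_eq_neg_one_of_analyticRank_eq_one W hr Dt)
    hK hodd h3 hH Dt β ι d₁ g hg w₀ hw₀ s hs

end Summit.BirchSwinnertonDyer.BirchSwinnertonDyer.Theorems.GenusExact.TwinSwap.ComponentRoad

end
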